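import Summits.ValiantsHypothesis.ValiantsHypothesis.Theorems.LacunarySymmetroidMatrixDescartesFiniteSectorSectorCeilingMTwo

/-!
# `MatrixDescartes` — line «stamp»: the STAMP CEILINGS `ν(2,7) ≤ 20 = n(2,6)` and `ν(2,8) ≤ 26 = n(2,7)` (kernel) — the degrees of the open
# targets `G7` and `G8` are the MAXIMAL ones

HONEST FRAMING.  Object-search cell `pub-symmetroid`, seat val-sym-door-p5 g7.  HELPER of the crux item `stmt-ValiantsHypothesis-18050` with NO closure
claim.  Continuation of `…FiniteSectorStampCeilingMTwo` (`StampLawAt 2 K n(2,K−1)` for `K ≤ 6` by `powersetCard` checks, whose enumeration does not scale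
to `K = 7`): here the finite cores are PRUNED NESTED enumerations (a sorted prefix already fixes all pair sums below the next value — `memP_prefix` of
`…FiniteSectorSectorCeilingMTwo`), decided in the kernel: `stampLawAt_two_seven : StampLawAt 2 7 20` and `stampLawAt_two_eight : StampLawAt 2 8 26`
(classical two-stamp postage numbers `n(2,6) = 20`, `n(2,7) = 26`; OEIS A001212).  Readings: the stamp-line targets `G7 = FullyRealisable 2 dA6 20` and
`G8` (degree `26` on an `A₇`, the «divergence cell» of `Lines/stamp.md`) ask for EXACTLY the maximal possible degrees; with `G6` realised (val-sym-engine-7,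
p609049) the m = 2 stamp register reads ν(2,K) = 4, 8, 12, 16 for K ≤ 6 and ν(2,7) ≤ 20, ν(2,8) ≤ 26 (upper sides only) — nothing is claimed about G7/G8.
Nothing here bears on the crux (asymptotic), on the doors, or on `VP ≠ VNP`.
[folklore] Postage-stamp bookkeeping on the proved T3 (`mem_sumset_of_fullPos`); no citation is load-bearing.
-/

-- `Summit.ValiantsHypothesis.ValiantsHypothesis.…` repeats a component by the D-0017 layout
-- (single-conjunct summit), which the `dupNamespace` linter flags; the name is mandated.
set_option linter.dupNamespace false

namespace Summit.ValiantsHypothesis.ValiantsHypothesis.Theorems.LacunarySymmetroidMatrixDescartes.FiniteSector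

open scoped BigOperators Matrix
open Polynomial
/-! ## `K = 7`: `ν(2,7) ≤ n(2,6) = 20` -/

set_option synthInstance.maxSize 2000000 in
set_option synthInstance.maxHeartbeats 2000000 in
set_option maxHeartbeats 4000000 in
/-- **Finite core of `n(2,6) = 20`** (pruned nested enumeration, `decide` in the kernel): no strictly increasing `1 < a < b < c < e < f < 23`
whose sorted prefixes keep `[0, next)` covered by pair sums makes `{0,1,a,b,c,e,f}` cover `[0, 21]` by pair sums (extremal bases:
`{1,3,5,7,9,10}`, covering exactly `[0, 20]`). [folklore] -/
theorem stampCheck_two_seven :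
    ∀ a ∈ List.range 23, (1 < a ∧ (∀ r ∈ List.range (min 22 a), (∃ x ∈ [0, 1], ∃ y ∈ [0, 1], x + y = r))) →
    ∀ b ∈ List.range 23, (a < b ∧ (∀ r ∈ List.range (min 22 b), (∃ x ∈ [0, 1, a], ∃ y ∈ [0, 1, a], x + y = r))) →
    ∀ c ∈ List.range 23, (b < c ∧ (∀ r ∈ List.range (min 22 c), (∃ x ∈ [0, 1, a, b], ∃ y ∈ [0, 1, a, b], x + y = r))) →
    ∀ e ∈ List.range 23, (c < e ∧ (∀ r ∈ List.range (min 22 e), (∃ x ∈ [0, 1, a, b, c], ∃ y ∈ [0, 1, a, b, c], x + y = r))) →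
    ∀ f ∈ List.range 23, (e < f ∧ (∀ r ∈ List.range (min 22 f), (∃ x ∈ [0, 1, a, b, c, e], ∃ y ∈ [0, 1, a, b, c, e], x + y = r))) →
    ¬ (∀ r ∈ List.range (22), (∃ x ∈ [0, 1, a, b, c, e, f], ∃ y ∈ [0, 1, a, b, c, e, f], x + y = r)) := by
  decide +kernel

/-- **`ν(2,7) ≤ 20 = n(2,6)`** — `StampLawAt 2 7 20`: every full-positive-rooted symmetric `2 × 2` half-pencil determinant with `7` terms has
degree `≤ 20` (T3 `mem_sumset_of_fullPos` ⇒ every `r ≤ deg` is a pair sum; values `0, 1` forced; capped at `22`, padded, sorted;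
`stampCheck_two_seven`).  This is the CEILING of the stamp-line target `G7` (`FullyRealisable 2 dA6… 20`), about which nothing is claimed here. [folklore] -/
theorem stampLawAt_two_seven : StampLawAt 2 7 20 := by
  intro d S hS hfull
  by_contra hdeg'
  have hdeg : 20 < (pencil d S).det.natDegree := not_le.mp hdeg'
  have hq : (pencil d S).det ≠ 0 := by
    intro h0
    rw [h0] at hdeg
    simp at hdeg
  have hmem : ∀ r, r ≤ (pencil d S).det.natDegree → ∃ i j : Fin 7, d i + d j = r := by
    intro r hr
    have hm := mem_sumset_of_fullPos d S hq hfull hr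
    rw [Finset.mem_image] at hm
    obtain ⟨s, -, hs⟩ := hm
    have hcard2 : Multiset.card (s : Multiset (Fin 7)) = 2 := s.2
    obtain ⟨i, j, hij⟩ := Multiset.card_eq_two.mp hcard2
    refine ⟨i, j, ?_⟩
    have hsum : ((s : Multiset (Fin 7)).map d).sum = d i + d j := by
      rw [hij]
      simp
    omega
  set cv : Fin 7 → ℕ := fun i => min (d i) 22 with hcv
  have hcvd : ∀ i, d i ≤ 21 → cv i = d i := fun i hi => by
    simp only [hcv]
    exact Nat.min_eq_left (by omega)
  have hcvle : ∀ i, cv i ≤ 22 := fun i => Nat.min_le_right _ _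
  set V : Finset ℕ := Finset.univ.image cv with hV
  have hcvV : ∀ i, cv i ∈ V := fun i => Finset.mem_image_of_mem cv (Finset.mem_univ i)
  have h0V : 0 ∈ V := by
    obtain ⟨i, j, hij⟩ := hmem 0 (Nat.zero_le _)
    have : cv i = 0 := by rw [hcvd i (by omega)]; omega
    exact this ▸ hcvV i
  have h1V : 1 ∈ V := by
    obtain ⟨i, j, hij⟩ := hmem 1 (by omega)
    rcases Nat.eq_zero_or_pos (d i) with hi | hi
    · have : cv j = 1 := by rw [hcvd j (by omega)]; omega
      exact this ▸ hcvV j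
    · have : cv i = 1 := by rw [hcvd i (by omega)]; omega
      exact this ▸ hcvV i
  have h1V' : 1 ∈ V.erase 0 := Finset.mem_erase.mpr ⟨by norm_num, h1V⟩
  set W : Finset ℕ := (V.erase 0).erase 1 with hW
  have hWsub : W ⊆ ((Finset.range 23).erase 0).erase 1 := by
    intro u hu
    rw [hW, Finset.mem_erase, Finset.mem_erase] at hu
    obtain ⟨hu1, hu0, huV⟩ := hu
    rw [hV, Finset.mem_image] at huV
    obtain ⟨i, -, rfl⟩ := huV
    rw [Finset.mem_erase, Finset.mem_erase, Finset.mem_range]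
    exact ⟨hu1, hu0, Nat.lt_succ_of_le (hcvle i)⟩
  have hWcard : W.card ≤ 5 := by
    have hVK : V.card ≤ 7 := by
      have := Finset.card_image_le (s := (Finset.univ : Finset (Fin 7))) (f := cv)
      simpa using this
    have h1 : (V.erase 0).card + 1 = V.card := Finset.card_erase_add_one h0V
    have h2 : W.card + 1 = (V.erase 0).card := by rw [hW]; exact Finset.card_erase_add_one h1V'
    omega
  obtain ⟨W', hWW', hW'sub, hW'card⟩ := Finset.exists_subsuperset_card_eq hWsub hWcard (by
    rw [Finset.card_erase_of_mem (by simp), Finset.card_erase_of_mem (by simp), Finset.card_range]; omega)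
  have hVW' : ∀ u ∈ V, u = 0 ∨ u = 1 ∨ u ∈ W' := by
    intro u hu
    by_cases hu0 : u = 0
    · exact Or.inl hu0
    by_cases hu1 : u = 1
    · exact Or.inr (Or.inl hu1)
    · exact Or.inr (Or.inr (hWW' (by rw [hW, Finset.mem_erase, Finset.mem_erase]; exact ⟨hu1, hu0, hu⟩)))
  have hlmem : ∀ u, u ∈ Finset.sort W' ↔ u ∈ W' := fun u => Finset.mem_sort _
  have hlsort : (Finset.sort W').SortedLT := Finset.sortedLT_sort W'
  have hllen : (Finset.sort W').length = 5 := by rw [Finset.length_sort, hW'card]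
  generalize hl : Finset.sort W' = l at hlmem hlsort hllen
  rcases l with _ | ⟨a, _ | ⟨b, _ | ⟨c, _ | ⟨e, _ | ⟨f, _ | ⟨zz, ll⟩⟩⟩⟩⟩⟩
  all_goals simp only [List.length_cons, List.length_nil] at hllen
  all_goals try omega
  have hmemR : ∀ u, u ∈ [a, b, c, e, f] → u ∈ List.range 23 := by
    intro u hu
    have hu' : u ∈ W' := (hlmem u).mp hu
    have := hW'sub hu'
    rw [Finset.mem_erase, Finset.mem_erase, Finset.mem_range] at this
    exact List.mem_range.mpr this.2.2
  have hgt1 : ∀ u, u ∈ [a, b, c, e, f] → 1 < u := by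
    intro u hu
    have hu' : u ∈ W' := (hlmem u).mp hu
    have := hW'sub hu'
    rw [Finset.mem_erase, Finset.mem_erase] at this
    omega
  have h1a : 1 < a := hgt1 a (by simp)
  have hmemP : ∀ r, r ≤ 21 → (∃ i j : Fin 7, d i + d j = r) → (∃ x ∈ [0, 1, a, b, c, e, f], ∃ y ∈ [0, 1, a, b, c, e, f], x + y = r) := by
    rintro r hr ⟨i, j, hij⟩
    have hi : cv i = d i := hcvd i (by omega)
    have hj : cv j = d j := hcvd j (by omega)
    have hin : ∀ u ∈ V, u ∈ [0, 1, a, b, c, e, f] := by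
      intro u hu
      rcases hVW' u hu with h | h | h
      · rw [h]; simp
      · rw [h]; simp
      · exact List.mem_cons_of_mem _ (List.mem_cons_of_mem _ ((hlmem u).mpr h))
    exact ⟨cv i, hin _ (hcvV i), cv j, hin _ (hcvV j), by rw [hi, hj]; exact hij⟩
  have hcovP : ∀ r, r ≤ 21 → (∃ x ∈ [0, 1, a, b, c, e, f], ∃ y ∈ [0, 1, a, b, c, e, f], x + y = r) := fun r hr => hmemP r hr (hmem r (by omega))
  have hlt1 : a < b := by
    have := hlsort (show (⟨0, by simp⟩ : Fin [a, b, c, e, f].length) < ⟨1, by simp⟩ from Fin.mk_lt_mk.mpr (by norm_num))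
    simpa using this
  have hlt2 : b < c := by
    have := hlsort (show (⟨1, by simp⟩ : Fin [a, b, c, e, f].length) < ⟨2, by simp⟩ from Fin.mk_lt_mk.mpr (by norm_num))
    simpa using this
  have hlt3 : c < e := by
    have := hlsort (show (⟨2, by simp⟩ : Fin [a, b, c, e, f].length) < ⟨3, by simp⟩ from Fin.mk_lt_mk.mpr (by norm_num))
    simpa using this
  have hlt4 : e < f := by
    have := hlsort (show (⟨3, by simp⟩ : Fin [a, b, c, e, f].length) < ⟨4, by simp⟩ from Fin.mk_lt_mk.mpr (by norm_num))
    simpa using this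
  have pre1 : (∀ r ∈ List.range (min 22 a), (∃ x ∈ [0, 1], ∃ y ∈ [0, 1], x + y = r)) := by
    intro r hr
    rw [List.mem_range] at hr
    have hrN : r < 22 := lt_of_lt_of_le hr (min_le_left _ _)
    have hrv : r < a := lt_of_lt_of_le hr (min_le_right _ _)
    have hrest : ∀ y ∈ [a, b, c, e, f], a ≤ y := by
      intro y hy
      simp only [List.mem_cons, List.mem_nil_iff, or_false] at hy
      omega
    exact memP_prefix (l₁ := [0, 1]) (l₂ := [a, b, c, e, f]) hrest hrv (hcovP r (by omega))
  have pre2 : (∀ r ∈ List.range (min 22 b), (∃ x ∈ [0, 1, a], ∃ y ∈ [0, 1, a], x + y = r)) := by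
    intro r hr
    rw [List.mem_range] at hr
    have hrN : r < 22 := lt_of_lt_of_le hr (min_le_left _ _)
    have hrv : r < b := lt_of_lt_of_le hr (min_le_right _ _)
    have hrest : ∀ y ∈ [b, c, e, f], b ≤ y := by
      intro y hy
      simp only [List.mem_cons, List.mem_nil_iff, or_false] at hy
      omega
    exact memP_prefix (l₁ := [0, 1, a]) (l₂ := [b, c, e, f]) hrest hrv (hcovP r (by omega))
  have pre3 : (∀ r ∈ List.range (min 22 c), (∃ x ∈ [0, 1, a, b], ∃ y ∈ [0, 1, a, b], x + y = r)) := by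
    intro r hr
    rw [List.mem_range] at hr
    have hrN : r < 22 := lt_of_lt_of_le hr (min_le_left _ _)
    have hrv : r < c := lt_of_lt_of_le hr (min_le_right _ _)
    have hrest : ∀ y ∈ [c, e, f], c ≤ y := by
      intro y hy
      simp only [List.mem_cons, List.mem_nil_iff, or_false] at hy
      omega
    exact memP_prefix (l₁ := [0, 1, a, b]) (l₂ := [c, e, f]) hrest hrv (hcovP r (by omega))
  have pre4 : (∀ r ∈ List.range (min 22 e), (∃ x ∈ [0, 1, a, b, c], ∃ y ∈ [0, 1, a, b, c], x + y = r)) := by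
    intro r hr
    rw [List.mem_range] at hr
    have hrN : r < 22 := lt_of_lt_of_le hr (min_le_left _ _)
    have hrv : r < e := lt_of_lt_of_le hr (min_le_right _ _)
    have hrest : ∀ y ∈ [e, f], e ≤ y := by
      intro y hy
      simp only [List.mem_cons, List.mem_nil_iff, or_false] at hy
      omega
    exact memP_prefix (l₁ := [0, 1, a, b, c]) (l₂ := [e, f]) hrest hrv (hcovP r (by omega))
  have pre5 : (∀ r ∈ List.range (min 22 f), (∃ x ∈ [0, 1, a, b, c, e], ∃ y ∈ [0, 1, a, b, c, e], x + y = r)) := by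
    intro r hr
    rw [List.mem_range] at hr
    have hrN : r < 22 := lt_of_lt_of_le hr (min_le_left _ _)
    have hrv : r < f := lt_of_lt_of_le hr (min_le_right _ _)
    have hrest : ∀ y ∈ [f], f ≤ y := by
      intro y hy
      simp only [List.mem_cons, List.mem_nil_iff, or_false] at hy
      omega
    exact memP_prefix (l₁ := [0, 1, a, b, c, e]) (l₂ := [f]) hrest hrv (hcovP r (by omega))
  exact stampCheck_two_seven a (hmemR a (by simp)) ⟨h1a, pre1⟩ b (hmemR b (by simp)) ⟨hlt1, pre2⟩ c (hmemR c (by simp)) ⟨hlt2, pre3⟩ e (hmemR e (by simp)) ⟨hlt3, pre4⟩ f (hmemR f (by simp)) ⟨hlt4, pre5⟩ (fun r hr => hcovP r (by have := List.mem_range.mp hr; omega))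
/-! ## `K = 8`: `ν(2,8) ≤ n(2,7) = 26` -/

set_option synthInstance.maxSize 2000000 in
set_option synthInstance.maxHeartbeats 2000000 in
set_option maxHeartbeats 4000000 in
/-- **Finite core of `n(2,7) = 26`** (pruned nested enumeration, `decide` in the kernel): no strictly increasing `1 < a < b < c < e < f < g < 29`
whose sorted prefixes keep `[0, next)` covered by pair sums makes `{0,1,a,b,c,e,f,g}` cover `[0, 27]` by pair sums (extremal bases:
`{1,3,5,7,8,17,18} / {1,3,4,9,10,12,13} / {1,2,5,8,11,12,13}`, covering exactly `[0, 26]`). [folklore] -/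
theorem stampCheck_two_eight :
    ∀ a ∈ List.range 29, (1 < a ∧ (∀ r ∈ List.range (min 28 a), (∃ x ∈ [0, 1], ∃ y ∈ [0, 1], x + y = r))) →
    ∀ b ∈ List.range 29, (a < b ∧ (∀ r ∈ List.range (min 28 b), (∃ x ∈ [0, 1, a], ∃ y ∈ [0, 1, a], x + y = r))) →
    ∀ c ∈ List.range 29, (b < c ∧ (∀ r ∈ List.range (min 28 c), (∃ x ∈ [0, 1, a, b], ∃ y ∈ [0, 1, a, b], x + y = r))) →
    ∀ e ∈ List.range 29, (c < e ∧ (∀ r ∈ List.range (min 28 e), (∃ x ∈ [0, 1, a, b, c], ∃ y ∈ [0, 1, a, b, c], x + y = r))) →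
    ∀ f ∈ List.range 29, (e < f ∧ (∀ r ∈ List.range (min 28 f), (∃ x ∈ [0, 1, a, b, c, e], ∃ y ∈ [0, 1, a, b, c, e], x + y = r))) →
    ∀ g ∈ List.range 29, (f < g ∧ (∀ r ∈ List.range (min 28 g), (∃ x ∈ [0, 1, a, b, c, e, f], ∃ y ∈ [0, 1, a, b, c, e, f], x + y = r))) →
    ¬ (∀ r ∈ List.range (28), (∃ x ∈ [0, 1, a, b, c, e, f, g], ∃ y ∈ [0, 1, a, b, c, e, f, g], x + y = r)) := by
  decide +kernel

/-- **`ν(2,8) ≤ 26 = n(2,7)`** — `StampLawAt 2 8 26`: every full-positive-rooted symmetric `2 × 2` half-pencil determinant with `8` terms has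
degree `≤ 26` (T3 `mem_sumset_of_fullPos` ⇒ every `r ≤ deg` is a pair sum; values `0, 1` forced; capped at `28`, padded, sorted;
`stampCheck_two_eight`).  This is the CEILING of the stamp-line target `G8` (`FullyRealisable 2 dA7… 26`), about which nothing is claimed here. [folklore] -/
theorem stampLawAt_two_eight : StampLawAt 2 8 26 := by
  intro d S hS hfull
  by_contra hdeg'
  have hdeg : 26 < (pencil d S).det.natDegree := not_le.mp hdeg'
  have hq : (pencil d S).det ≠ 0 := by
    intro h0
    rw [h0] at hdeg
    simp at hdeg
  have hmem : ∀ r, r ≤ (pencil d S).det.natDegree → ∃ i j : Fin 8, d i + d j = r := by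
    intro r hr
    have hm := mem_sumset_of_fullPos d S hq hfull hr
    rw [Finset.mem_image] at hm
    obtain ⟨s, -, hs⟩ := hm
    have hcard2 : Multiset.card (s : Multiset (Fin 8)) = 2 := s.2
    obtain ⟨i, j, hij⟩ := Multiset.card_eq_two.mp hcard2
    refine ⟨i, j, ?_⟩
    have hsum : ((s : Multiset (Fin 8)).map d).sum = d i + d j := by
      rw [hij]
      simp
    omega
  set cv : Fin 8 → ℕ := fun i => min (d i) 28 with hcv
  have hcvd : ∀ i, d i ≤ 27 → cv i = d i := fun i hi => by
    simp only [hcv]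
    exact Nat.min_eq_left (by omega)
  have hcvle : ∀ i, cv i ≤ 28 := fun i => Nat.min_le_right _ _
  set V : Finset ℕ := Finset.univ.image cv with hV
  have hcvV : ∀ i, cv i ∈ V := fun i => Finset.mem_image_of_mem cv (Finset.mem_univ i)
  have h0V : 0 ∈ V := by
    obtain ⟨i, j, hij⟩ := hmem 0 (Nat.zero_le _)
    have : cv i = 0 := by rw [hcvd i (by omega)]; omega
    exact this ▸ hcvV i
  have h1V : 1 ∈ V := by
    obtain ⟨i, j, hij⟩ := hmem 1 (by omega)
    rcases Nat.eq_zero_or_pos (d i) with hi | hi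
    · have : cv j = 1 := by rw [hcvd j (by omega)]; omega
      exact this ▸ hcvV j
    · have : cv i = 1 := by rw [hcvd i (by omega)]; omega
      exact this ▸ hcvV i
  have h1V' : 1 ∈ V.erase 0 := Finset.mem_erase.mpr ⟨by norm_num, h1V⟩
  set W : Finset ℕ := (V.erase 0).erase 1 with hW
  have hWsub : W ⊆ ((Finset.range 29).erase 0).erase 1 := by
    intro u hu
    rw [hW, Finset.mem_erase, Finset.mem_erase] at hu
    obtain ⟨hu1, hu0, huV⟩ := hu
    rw [hV, Finset.mem_image] at huV
    obtain ⟨i, -, rfl⟩ := huV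
    rw [Finset.mem_erase, Finset.mem_erase, Finset.mem_range]
    exact ⟨hu1, hu0, Nat.lt_succ_of_le (hcvle i)⟩
  have hWcard : W.card ≤ 6 := by
    have hVK : V.card ≤ 8 := by
      have := Finset.card_image_le (s := (Finset.univ : Finset (Fin 8))) (f := cv)
      simpa using this
    have h1 : (V.erase 0).card + 1 = V.card := Finset.card_erase_add_one h0V
    have h2 : W.card + 1 = (V.erase 0).card := by rw [hW]; exact Finset.card_erase_add_one h1V'
    omega
  obtain ⟨W', hWW', hW'sub, hW'card⟩ := Finset.exists_subsuperset_card_eq hWsub hWcard (by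
    rw [Finset.card_erase_of_mem (by simp), Finset.card_erase_of_mem (by simp), Finset.card_range]; omega)
  have hVW' : ∀ u ∈ V, u = 0 ∨ u = 1 ∨ u ∈ W' := by
    intro u hu
    by_cases hu0 : u = 0
    · exact Or.inl hu0
    by_cases hu1 : u = 1
    · exact Or.inr (Or.inl hu1)
    · exact Or.inr (Or.inr (hWW' (by rw [hW, Finset.mem_erase, Finset.mem_erase]; exact ⟨hu1, hu0, hu⟩)))
  have hlmem : ∀ u, u ∈ Finset.sort W' ↔ u ∈ W' := fun u => Finset.mem_sort _
  have hlsort : (Finset.sort W').SortedLT := Finset.sortedLT_sort W'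
  have hllen : (Finset.sort W').length = 6 := by rw [Finset.length_sort, hW'card]
  generalize hl : Finset.sort W' = l at hlmem hlsort hllen
  rcases l with _ | ⟨a, _ | ⟨b, _ | ⟨c, _ | ⟨e, _ | ⟨f, _ | ⟨g, _ | ⟨zz, ll⟩⟩⟩⟩⟩⟩⟩
  all_goals simp only [List.length_cons, List.length_nil] at hllen
  all_goals try omega
  have hmemR : ∀ u, u ∈ [a, b, c, e, f, g] → u ∈ List.range 29 := by
    intro u hu
    have hu' : u ∈ W' := (hlmem u).mp hu
    have := hW'sub hu'
    rw [Finset.mem_erase, Finset.mem_erase, Finset.mem_range] at this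
    exact List.mem_range.mpr this.2.2
  have hgt1 : ∀ u, u ∈ [a, b, c, e, f, g] → 1 < u := by
    intro u hu
    have hu' : u ∈ W' := (hlmem u).mp hu
    have := hW'sub hu'
    rw [Finset.mem_erase, Finset.mem_erase] at this
    omega
  have h1a : 1 < a := hgt1 a (by simp)
  have hmemP : ∀ r, r ≤ 27 → (∃ i j : Fin 8, d i + d j = r) → (∃ x ∈ [0, 1, a, b, c, e, f, g], ∃ y ∈ [0, 1, a, b, c, e, f, g], x + y = r) := by
    rintro r hr ⟨i, j, hij⟩
    have hi : cv i = d i := hcvd i (by omega)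
    have hj : cv j = d j := hcvd j (by omega)
    have hin : ∀ u ∈ V, u ∈ [0, 1, a, b, c, e, f, g] := by
      intro u hu
      rcases hVW' u hu with h | h | h
      · rw [h]; simp
      · rw [h]; simp
      · exact List.mem_cons_of_mem _ (List.mem_cons_of_mem _ ((hlmem u).mpr h))
    exact ⟨cv i, hin _ (hcvV i), cv j, hin _ (hcvV j), by rw [hi, hj]; exact hij⟩
  have hcovP : ∀ r, r ≤ 27 → (∃ x ∈ [0, 1, a, b, c, e, f, g], ∃ y ∈ [0, 1, a, b, c, e, f, g], x + y = r) := fun r hr => hmemP r hr (hmem r (by omega))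
  have hlt1 : a < b := by
    have := hlsort (show (⟨0, by simp⟩ : Fin [a, b, c, e, f, g].length) < ⟨1, by simp⟩ from Fin.mk_lt_mk.mpr (by norm_num))
    simpa using this
  have hlt2 : b < c := by
    have := hlsort (show (⟨1, by simp⟩ : Fin [a, b, c, e, f, g].length) < ⟨2, by simp⟩ from Fin.mk_lt_mk.mpr (by norm_num))
    simpa using this
  have hlt3 : c < e := by
    have := hlsort (show (⟨2, by simp⟩ : Fin [a, b, c, e, f, g].length) < ⟨3, by simp⟩ from Fin.mk_lt_mk.mpr (by norm_num))
    simpa using this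
  have hlt4 : e < f := by
    have := hlsort (show (⟨3, by simp⟩ : Fin [a, b, c, e, f, g].length) < ⟨4, by simp⟩ from Fin.mk_lt_mk.mpr (by norm_num))
    simpa using this
  have hlt5 : f < g := by
    have := hlsort (show (⟨4, by simp⟩ : Fin [a, b, c, e, f, g].length) < ⟨5, by simp⟩ from Fin.mk_lt_mk.mpr (by norm_num))
    simpa using this
  have pre1 : (∀ r ∈ List.range (min 28 a), (∃ x ∈ [0, 1], ∃ y ∈ [0, 1], x + y = r)) := by
    intro r hr
    rw [List.mem_range] at hr
    have hrN : r < 28 := lt_of_lt_of_le hr (min_le_left _ _)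
    have hrv : r < a := lt_of_lt_of_le hr (min_le_right _ _)
    have hrest : ∀ y ∈ [a, b, c, e, f, g], a ≤ y := by
      intro y hy
      simp only [List.mem_cons, List.mem_nil_iff, or_false] at hy
      omega
    exact memP_prefix (l₁ := [0, 1]) (l₂ := [a, b, c, e, f, g]) hrest hrv (hcovP r (by omega))
  have pre2 : (∀ r ∈ List.range (min 28 b), (∃ x ∈ [0, 1, a], ∃ y ∈ [0, 1, a], x + y = r)) := by
    intro r hr
    rw [List.mem_range] at hr
    have hrN : r < 28 := lt_of_lt_of_le hr (min_le_left _ _)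
    have hrv : r < b := lt_of_lt_of_le hr (min_le_right _ _)
    have hrest : ∀ y ∈ [b, c, e, f, g], b ≤ y := by
      intro y hy
      simp only [List.mem_cons, List.mem_nil_iff, or_false] at hy
      omega
    exact memP_prefix (l₁ := [0, 1, a]) (l₂ := [b, c, e, f, g]) hrest hrv (hcovP r (by omega))
  have pre3 : (∀ r ∈ List.range (min 28 c), (∃ x ∈ [0, 1, a, b], ∃ y ∈ [0, 1, a, b], x + y = r)) := by
    intro r hr
    rw [List.mem_range] at hr
    have hrN : r < 28 := lt_of_lt_of_le hr (min_le_left _ _)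
    have hrv : r < c := lt_of_lt_of_le hr (min_le_right _ _)
    have hrest : ∀ y ∈ [c, e, f, g], c ≤ y := by
      intro y hy
      simp only [List.mem_cons, List.mem_nil_iff, or_false] at hy
      omega
    exact memP_prefix (l₁ := [0, 1, a, b]) (l₂ := [c, e, f, g]) hrest hrv (hcovP r (by omega))
  have pre4 : (∀ r ∈ List.range (min 28 e), (∃ x ∈ [0, 1, a, b, c], ∃ y ∈ [0, 1, a, b, c], x + y = r)) := by
    intro r hr
    rw [List.mem_range] at hr
    have hrN : r < 28 := lt_of_lt_of_le hr (min_le_left _ _)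
    have hrv : r < e := lt_of_lt_of_le hr (min_le_right _ _)
    have hrest : ∀ y ∈ [e, f, g], e ≤ y := by
      intro y hy
      simp only [List.mem_cons, List.mem_nil_iff, or_false] at hy
      omega
    exact memP_prefix (l₁ := [0, 1, a, b, c]) (l₂ := [e, f, g]) hrest hrv (hcovP r (by omega))
  have pre5 : (∀ r ∈ List.range (min 28 f), (∃ x ∈ [0, 1, a, b, c, e], ∃ y ∈ [0, 1, a, b, c, e], x + y = r)) := by
    intro r hr
    rw [List.mem_range] at hr
    have hrN : r < 28 := lt_of_lt_of_le hr (min_le_left _ _)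
    have hrv : r < f := lt_of_lt_of_le hr (min_le_right _ _)
    have hrest : ∀ y ∈ [f, g], f ≤ y := by
      intro y hy
      simp only [List.mem_cons, List.mem_nil_iff, or_false] at hy
      omega
    exact memP_prefix (l₁ := [0, 1, a, b, c, e]) (l₂ := [f, g]) hrest hrv (hcovP r (by omega))
  have pre6 : (∀ r ∈ List.range (min 28 g), (∃ x ∈ [0, 1, a, b, c, e, f], ∃ y ∈ [0, 1, a, b, c, e, f], x + y = r)) := by
    intro r hr
    rw [List.mem_range] at hr
    have hrN : r < 28 := lt_of_lt_of_le hr (min_le_left _ _)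
    have hrv : r < g := lt_of_lt_of_le hr (min_le_right _ _)
    have hrest : ∀ y ∈ [g], g ≤ y := by
      intro y hy
      simp only [List.mem_cons, List.mem_nil_iff, or_false] at hy
      omega
    exact memP_prefix (l₁ := [0, 1, a, b, c, e, f]) (l₂ := [g]) hrest hrv (hcovP r (by omega))
  exact stampCheck_two_eight a (hmemR a (by simp)) ⟨h1a, pre1⟩ b (hmemR b (by simp)) ⟨hlt1, pre2⟩ c (hmemR c (by simp)) ⟨hlt2, pre3⟩ e (hmemR e (by simp)) ⟨hlt3, pre4⟩ f (hmemR f (by simp)) ⟨hlt4, pre5⟩ g (hmemR g (by simp)) ⟨hlt5, pre6⟩ (fun r hr => hcovP r (by have := List.mem_range.mp hr; omega))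

end Summit.ValiantsHypothesis.ValiantsHypothesis.Theorems.LacunarySymmetroidMatrixDescartes.FiniteSector
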